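import Summits.KontsevichZagierPeriods.KontsevichZagierPeriods.Theses.SymplecticScissors
import Summits.KontsevichZagierPeriods.KontsevichZagierPeriods.Theorems.SymplecticScissorsTypeAGenerationRatOneVarLayer
import Summits.KontsevichZagierPeriods.KontsevichZagierPeriods.Theorems.SymplecticScissorsTypeAGenerationStubRenameSpan
import Summits.KontsevichZagierPeriods.KontsevichZagierPeriods.Theorems.SymplecticScissorsTypeAGenerationStubModuleDisjoint
import Summits.KontsevichZagierPeriods.KontsevichZagierPeriods.Theorems.SymplecticScissorsTypeAGenerationChangeOfVariablesDimOne
import Summits.KontsevichZagierPeriods.KontsevichZagierPeriods.Theorems.SymplecticScissorsTypeAGenerationStubSqrtInstance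
import Literature.NumberTheory.Transcendental.AyoubPeriodSeriesLocalizing

/-!
# `TypeAGeneration` (stmt-KontsevichZagierPeriods-18392), line `Sketch`: SECTOR THEOREMS of cycle 2
in clean form (registered stub `stub_ratOneVarTimesDisjoint`; lead)

The crux is Ayoub's Conjecture 1.1 (Ann. of Math. 181 (2015)) = Fresán 2024 Conj. 3.5: the kernel
of `∫_{[0,1]^∞}` on `𝒪_{ℚ-alg}(𝔻̄^∞)` (`AyoubRel.Oan`) is the `ℚ`-span `𝕊` of the type-(a) elements
`∂G/∂zₙ − G|_{zₙ=1} + G|_{zₙ=0}`. This file packages the STRUCTURAL consequences of the cycle-2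
landings of the line `Sketch`:

* `moduleDisjoint` — **`𝕊` is a module under disjoint-variable products** (renaming invariance R
  `stub_renameSpan` + M1 `stub_moduleDisjoint_of`): `F ∈ 𝕊`, `L ∈ 𝒪_{ℚ-alg}` free of the variables
  of `F` ⟹ `F·L ∈ 𝕊`. So Ayoub's type-(b) generators `f·L` (`∫f = 0`, disjoint variables) of the
  relative theorem are type (a) as soon as `f` is.
* `stub_ratOneVarTimesDisjoint` — **Layer 1 ⊗ disjoint products**: a one-variable RATIONAL kernel
  element (Layer 1, `stub_ratOneVarLayer`) times any disjoint `L ∈ 𝒪_{ℚ-alg}` is type (a).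
* `sqrtInstance` — **the first IRRATIONAL ALGEBRAIC instance**, unconditional: `√(4 − z₀) − (2/3)(8 − 3√3)`
  is type (a) (F6 `stub_sqrtInstance_of` fed with the landed Layer 1.5 `stub_genusZeroWithRoomLayer`).
(See also, landed separately: F2 `stub_multiPieceRatLayer` — finite sums of one-variable rational
pieces in different variables with total `∫ = 0` are type (a) —, and F7 `stub_barrierElementTypeA` —
the barrier catalogue's element `2z₀/(2 − z₀²) − 1/(2 − z₀)`, which has NO one-variable certificate
(`Literature.Barriers.KontsevichZagierPeriods.KZ.kernelElt_not_stokes_one_variable`), IS type (a).)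

References: Ayoub 2015 Conj. 1.1, Rem. 1.2; Ayoub, *La version relative … revisitée*, Thm. 1.1 (b).
-/

noncomputable section

-- `Summit.KontsevichZagierPeriods.KontsevichZagierPeriods.…` is the tree's mandated layout (single-conjunct summit).
set_option linter.dupNamespace false

namespace Summit.KontsevichZagierPeriods.KontsevichZagierPeriods.TypeAGenerationLine

open Finsupp MvPowerSeries
open Literature.NumberTheory.Transcendental
open Literature.NumberTheory.Transcendental.AyoubRel

/-- The binomial germ `(1 − zᵢ/α)^a ∈ ℂ[[z]]`: Mathlib's `(1 + X)^a` (`PowerSeries.binomialSeries`)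
rescaled by `X ↦ −α⁻¹ X` and renamed into the variable `zᵢ` (as `AyoubRel.perGerm`). -/
local notation3 "binGerm[" i ", " α ", " a "]" =>
  (MvPowerSeries.rename (⇑(axisEmb i))
    (PowerSeries.rescale (-(α : ℂ)⁻¹) (PowerSeries.binomialSeries ℂ (a : ℂ)) : MvPowerSeries Unit ℂ) :
    CSeries)

/-- **MODULE STRUCTURE of the type-(a) span under disjoint-variable products** (R + M1): if `F` is
type (a) and `L ∈ 𝒪_{ℚ-alg}(𝔻̄^∞)` involves no variable of `F`, then `F·L` is type (a).
[cite: AyoubRelKZRevisited, Théorème 1.1 (b)] -/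
theorem moduleDisjoint (F L : CSeries)
    (hF : F ∈ kSpan (algebraMap ℚ ℂ) {x : CSeries | ∃ G ∈ Oan (algebraMap ℚ ℂ), ∃ n : ℕ, x = relAC n G})
    (hL : L ∈ Oan (algebraMap ℚ ℂ)) (hdis : ∀ l : ℕ, UsesVar L l → ¬ UsesVar F l) :
    F * L ∈ kSpan (algebraMap ℚ ℂ) {x : CSeries | ∃ G ∈ Oan (algebraMap ℚ ℂ), ∃ n : ℕ, x = relAC n G} :=
  stub_moduleDisjoint_of stub_renameSpan F L hF hL hdis

/-- **Registered stub `stub_ratOneVarTimesDisjoint` — Layer 1 ⊗ disjoint products**: a one-variable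
rational element `F ∈ 𝒪_{ℚ-alg}(𝔻̄^∞)` (variable `zᵢ`, `B·F = A` with `A, B ∈ ℚ̄[zᵢ]`, `B ≠ 0`) with
`∫F = 0`, times any `L ∈ 𝒪_{ℚ-alg}(𝔻̄^∞)` free of `zᵢ`, is type (a) (Layer 1 `stub_ratOneVarLayer`
+ `moduleDisjoint`). [cite: Ayoub2015, Conj. 1.1] -/
theorem stub_ratOneVarTimesDisjoint :
    ∀ (i : ℕ) (F L : CSeries), F ∈ Oan (algebraMap ℚ ℂ) → (∀ l : ℕ, UsesVar F l → l = i) →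
      (∃ A B : Polynomial ℂ, B ≠ 0 ∧ (∀ n, IsAlgebraic ℚ (A.coeff n)) ∧
        (∀ n, IsAlgebraic ℚ (B.coeff n)) ∧
        Polynomial.aeval (X i : CSeries) B * F = Polynomial.aeval (X i : CSeries) A) →
      intC F = 0 → L ∈ Oan (algebraMap ℚ ℂ) → ¬ UsesVar L i →
      F * L ∈ kSpan (algebraMap ℚ ℂ) {x : CSeries | ∃ G ∈ Oan (algebraMap ℚ ℂ), ∃ n : ℕ, x = relAC n G} :=
  fun i F L hF hvar hrat h0 hL hLi =>
    moduleDisjoint F L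
      (stub_ratOneVarLayer ℚ (algebraMap ℚ ℂ) (fun c => isAlgebraic_algebraMap c) i F hF hvar hrat h0) hL
      fun l hl hFl => hLi (hvar l hFl ▸ hl)

/-- **THE FIRST IRRATIONAL ALGEBRAIC INSTANCE of Conj. 1.1 certified inside type (a)**, unconditional:
`√(4 − z₀) − (2/3)(8 − 3√3) = 2(1 − z₀/4)^{1/2} − (16/3 − 2√3)` is type (a) (F6 `stub_sqrtInstance_of`
+ Layer 1.5 `stub_genusZeroWithRoomLayer`). [cite: Ayoub2015, Conj. 1.1] -/
theorem sqrtInstance :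
    (2 : ℂ) • binGerm[0, (4 : ℂ), ((1 / 2 : ℚ) : ℂ)] - C ((16 / 3 : ℂ) - 2 * ((Real.sqrt 3 : ℝ) : ℂ)) ∈
      kSpan (algebraMap ℚ ℂ) {x : CSeries | ∃ G ∈ Oan (algebraMap ℚ ℂ), ∃ n : ℕ, x = relAC n G} :=
  stub_sqrtInstance_of stub_genusZeroWithRoomLayer

end Summit.KontsevichZagierPeriods.KontsevichZagierPeriods.TypeAGenerationLine
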